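import Summits.BirchSwinnertonDyer.BirchSwinnertonDyer.Theorems.GenusKolyvaginAtTwoShaCardDvdPowAtTwoRTResidualOfPairBound
import HarnessLib

/-!
# Route `GenusKolyvaginAtTwo`, cruxes U_T′ `ShaCardDvdPowAtTwoRT` (stmt-BirchSwinnertonDyer-23469, `Δ < 0`) and U⁺_T `ShaCardDvdPowAtTwoPosT`
# (stmt-BirchSwinnertonDyer-23378, `Δ > 0`): THE FRAME PACKAGE OF THE PAIR SANDWICH FROM THE FRAME ALONE (no habitat, no sign of `Δ`,
# no reduction type, no Kolyvagin descent over `K`)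

Seat `bsd-line-gk2-p3` g27 (PROVER seat 3/3, cell `bsd-f1-sign2`), `--supports` (helper; closes nothing).  THEOREMS ONLY (no definition, no
named fact, no `sorry`); standard axioms.  BSD is NOT proved by any of this; U_T′ / U⁺_T / Q4_T are NOT proved by this file.

WHY.  LINE 19 (`rational_pair_descent`, LEAD gk2-p1 g19) proves U_T on the cut by PAIRCOUNT + SANDWICH′; the K-side inputs of its sandwich
(`rank E(K) ≤ 1`, the Kramer class, «τ-invariant classes are restrictions», finiteness of `Ш(E/K)[2^∞]`) were all taken `…_onHabitat` (an odd
multiplicative prime, `Δ < 0`, Kolyvagin's descent over `K` at `2`, gk2-p4 g21/g22).  This file and its sequel `…RTPairSandwichSignFree` re-assemble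
the SAME count from the FRAME ALONE — `K` quadratic, `τ ≠ 1`, `E(K)[2] = 0`, `rank E(K) ≤ 1`, ONE point `y ∈ E(K)` with `τy + y` torsion and
`2^(M+1) ∤ y`, and finiteness of the two `ℚ`-SIDES — so that the upper half of Kolyvagin-exactness at `2` becomes, on BOTH signs of `Δ` and without
any reduction-type hypothesis, «the `ℚ`-side sharp exponent (B2Q-shape, Kolyvagin's Theorem B₂ over `ℚ`) + descent algebra».  Here:

* §1 `exists_framePackage_of_rank_le_one` — the LEAD's frame package (`exists_framePackage_onHabitat`, `…RTRestrictionKernelNontrivial`) from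
  the frame alone: `Q₀ ∉ 2E(K)`, `m` odd, `τ(mQ₀) + mQ₀ = 0`, `τ` trivial on `E(K)/2E(K)`, `mQ₀ ≠ τQ − Q`;
  `exists_ne_zero_resBaseChange_eq_zero_of_frame` — the KRAMER CLASS: `ker(H¹(ℚ, E) → H¹(K, E_K)) ≠ 0`;
  `exists_fixed_half_of_frame`; `exists_resBaseChange_eq_of_conjH1Points_eq_of_frame` — τ-INVARIANT classes of `H¹(K, E_K)` ARE RESTRICTIONS.
* §2 `finite_and_natCard_comap_resBaseChange_shaPrimary_le_of_relIndex` — `res⁻¹(Ш(E/K)[2^∞])` is FINITE with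
  `#res⁻¹(Ш(E/K)[2^∞]) ≤ #Ш(E/ℚ)[2^∞] · [res⁻¹Ш(E_K) : Ш(E/ℚ) ∩ ·]` as soon as `Ш(E/ℚ)[2^∞]` is finite and the relaxed index is non-zero.

HONEST FRAMING: descent algebra (Kramer 1981 / Gross §5 / Serre I §5.8), proofs copied from the LEAD's habitat versions with the habitat inputs
turned into the displayed frame hypotheses; beyond print: no.  BSD is NOT proved; no item is closed.

References: [Kramer1981] §2 Prop. 3, proof of Thm. 2; [GrossLMS1991] §5 (5.1)–(5.3), Prop. 5.3; [SerreGaloisCohomology1997] I §2.4 Prop. 9,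
I §2.6 (b), I §5.8; [SilvermanAEC2009] X.§4.
-/

set_option autoImplicit false
set_option linter.dupNamespace false -- `Summit.<P>.<Sub>` repeats `BirchSwinnertonDyer` (D-0017)

noncomputable section

open scoped Classical

namespace Summit.BirchSwinnertonDyer.BirchSwinnertonDyer.Theorems.GenusExact.PlusDescent

open Literature.NumberTheory.EllipticCurves Literature.NumberTheory.GaloisRepresentations WeierstrassCurve NumberField
  IsDedekindDomain Field AddSubgroup
open Summit.BirchSwinnertonDyer.Rank1Residual
open Summit.BirchSwinnertonDyer.BirchSwinnertonDyer.Theorems.GenusExact.SelmerDescent (mem_comap_resBaseChange_shaPrimary_iff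
  two_nsmul_eq_zero_of_resBaseChange_eq_zero)


/-! ## §1 The frame package from the frame alone -/

section Frame

variable (W : WeierstrassCurve ℚ) [W.IsElliptic] (K : Type) [Field K] [NumberField K]

/-- **The frame package from the frame alone** (the LEAD's `exists_framePackage_onHabitat`, habitat-free): `[K:ℚ] = 2`, `τ ≠ 1`,
`E(K)[2] = 0`, `rank E(K) ≤ 1`, a point `y ∈ E(K)` with `τy + y` torsion and `2^(M+1) ∤ y`.  Then there are `Q₀ ∈ E(K)` and an ODD `m` with:
`Q₀ ∉ 2E(K)`; `τ(m • Q₀) + m • Q₀ = 0`; `τQ − Q ∈ 2E(K)` for every `Q`; `m • Q₀ ≠ τQ − Q` for every `Q`; any two points outside `2E(K)` differ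
by an element of `2E(K)`.  [cite: GrossLMS1991, §5 Prop. 5.3] [cite: Kramer1981, proof of Thm. 2] [cite: SilvermanAEC2009, X.§4] -/
theorem exists_framePackage_of_rank_le_one (h2 : Module.finrank ℚ K = 2) {τ : K ≃ₐ[ℚ] K} (hτ : τ ≠ 1)
    (h2tors : ∀ P : (W.baseChange K).toAffine.Point, (2 : ℤ) • P = 0 → P = 0)
    (hrk : (W.baseChange K).mordellWeilRank ≤ 1)
    (y : (W.baseChange K).toAffine.Point) (M : ℕ)
    (hndiv : ∀ Q : (W.baseChange K).toAffine.Point, ((2 ^ (M + 1) : ℕ) : ℤ) • Q ≠ y)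
    (hanti : IsOfFinAddOrder (Affine.Point.map (W' := W) (τ : K →ₐ[ℚ] K) y + y)) :
    ∃ (Q₀ : (W.baseChange K).toAffine.Point) (m : ℕ), Odd m ∧
      (∀ R : (W.baseChange K).toAffine.Point, (2 : ℤ) • R ≠ Q₀) ∧
      (∀ P : (W.baseChange K).toAffine.Point, (2 : ℤ) • P = 0 → P = 0) ∧
      Affine.Point.map (W' := W) (τ : K →ₐ[ℚ] K) (m • Q₀) + m • Q₀ = 0 ∧
      (∀ Q : (W.baseChange K).toAffine.Point, ∃ R : (W.baseChange K).toAffine.Point,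
        (2 : ℤ) • R = Affine.Point.map (W' := W) (τ : K →ₐ[ℚ] K) Q - Q) ∧
      (∀ Q : (W.baseChange K).toAffine.Point, Affine.Point.map (W' := W) (τ : K →ₐ[ℚ] K) Q - Q ≠ m • Q₀) ∧
      (∀ x z : (W.baseChange K).toAffine.Point, (¬ ∃ S : (W.baseChange K).toAffine.Point, (2 : ℤ) • S = x) →
        (¬ ∃ S : (W.baseChange K).toAffine.Point, (2 : ℤ) • S = z) → ∃ S : (W.baseChange K).toAffine.Point, (2 : ℤ) • S = x - z) := by
  haveI : Fact (Nat.Prime 2) := ⟨Nat.prime_two⟩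
  haveI hell : (W.baseChange K).IsElliptic := inferInstanceAs ((W.map (algebraMap ℚ K)).IsElliptic)
  have hττ : τ * τ = 1 := mul_self_eq_one_of_ne_one K h2 τ hτ
  set τm := WeierstrassCurve.Affine.Point.map (W' := W) (τ : K →ₐ[ℚ] K) with hτm
  -- `Q₀` with `2^(n₀) Q₀ = y`, `Q₀ ∉ 2E(K)` (largest `n₀ ≤ M`)
  obtain ⟨n₀, Q₀, -, hQ₀, hQ₀2⟩ : ∃ (n₀ : ℕ) (Q₀ : (W.baseChange K).toAffine.Point), n₀ ≤ M ∧ ((2 ^ n₀ : ℕ) : ℤ) • Q₀ = y ∧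
      ∀ R : (W.baseChange K).toAffine.Point, (2 : ℤ) • R ≠ Q₀ := by
    let Pdiv : ℕ → Prop := fun n ↦ ∃ Q : (W.baseChange K).toAffine.Point, ((2 ^ n : ℕ) : ℤ) • Q = y
    have hP0 : Pdiv 0 := ⟨y, by rw [pow_zero, Nat.cast_one, one_zsmul]⟩
    obtain ⟨Q₀, hQ₀⟩ : Pdiv (Nat.findGreatest Pdiv M) := Nat.findGreatest_spec (Nat.zero_le M) hP0
    refine ⟨Nat.findGreatest Pdiv M, Q₀, Nat.findGreatest_le M, hQ₀, fun R hR ↦ ?_⟩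
    have hP : ((2 ^ (Nat.findGreatest Pdiv M + 1) : ℕ) : ℤ) • R = y := by
      rw [pow_succ, Nat.cast_mul, mul_smul]
      have h2R : ((2 : ℕ) : ℤ) • R = Q₀ := by exact_mod_cast hR
      rw [h2R, hQ₀]
    by_cases hlt : Nat.findGreatest Pdiv M + 1 ≤ M
    · exact Nat.findGreatest_is_greatest (Nat.lt_succ_self _) hlt ⟨R, hP⟩
    · have heq : Nat.findGreatest Pdiv M = M := by have := Nat.findGreatest_le (P := Pdiv) M; omega
      rw [heq] at hP
      exact hndiv R hP
  have ht : IsOfFinAddOrder (τm Q₀ + Q₀) := by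
    refine isOfFinAddOrder_of_zsmul (n := ((2 ^ n₀ : ℕ) : ℤ)) (by positivity) ?_
    have heq : ((2 ^ n₀ : ℕ) : ℤ) • (τm Q₀ + Q₀) = τm y + y := by rw [smul_add, ← map_zsmul, hQ₀]
    rw [heq]
    exact hanti
  have hmodd : Odd (addOrderOf (τm Q₀ + Q₀)) := odd_addOrderOf_of_forall_two_smul_eq_zero (W.baseChange K) h2tors ht
  set m := addOrderOf (τm Q₀ + Q₀) with hm
  have hPanti : τm (m • Q₀) + m • Q₀ = 0 := by
    rw [map_nsmul, ← nsmul_add, hm, addOrderOf_nsmul_eq_zero]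
  set N2 : AddSubgroup (W.baseChange K).toAffine.Point := (zsmulAddGroupHom (α := (W.baseChange K).toAffine.Point) ((2 : ℕ) : ℤ)).range
    with hN2
  have hmemN2 : ∀ x, x ∈ N2 ↔ ∃ z : (W.baseChange K).toAffine.Point, (2 : ℤ) • z = x := fun x ↦ by
    simp only [hN2, AddMonoidHom.mem_range, zsmulAddGroupHom_apply, Nat.cast_ofNat]
  have htors1 : Nat.card ((W.baseChange K).toAffine.Point[((2 : ℕ) : ℤ)]) = 1 := by
    rw [Nat.card_eq_one_iff_unique]
    refine ⟨⟨fun x z ↦ Subtype.ext ?_⟩, ⟨0⟩⟩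
    have hx : (2 : ℤ) • (x : (W.baseChange K).toAffine.Point) = 0 := by exact_mod_cast mem_torsionBy_iff.mp x.2
    have hz : (2 : ℤ) • (z : (W.baseChange K).toAffine.Point) = 0 := by exact_mod_cast mem_torsionBy_iff.mp z.2
    rw [h2tors _ hx, h2tors _ hz]
  have hcardV : Nat.card ((W.baseChange K).toAffine.Point ⧸ N2) ≤ 2 := by
    rw [hN2, natCard_quotient_range_zsmul (W.baseChange K) (n := 2) two_ne_zero, htors1, mul_one]
    calc 2 ^ (W.baseChange K).mordellWeilRank ≤ 2 ^ 1 := Nat.pow_le_pow_right (by norm_num) hrk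
      _ = 2 := by norm_num
  haveI : Finite ((W.baseChange K).toAffine.Point ⧸ N2) := by
    apply Nat.finite_of_card_ne_zero
    rw [hN2, natCard_quotient_range_zsmul (W.baseChange K) (n := 2) two_ne_zero, htors1, mul_one]
    positivity
  have hV : ∀ x z : (W.baseChange K).toAffine.Point ⧸ N2, x ≠ 0 → z ≠ 0 → x = z := by
    intro x z hx hz
    by_contra hxz
    haveI : Fintype ((W.baseChange K).toAffine.Point ⧸ N2) := Fintype.ofFinite _
    have h3 : 2 < Fintype.card ((W.baseChange K).toAffine.Point ⧸ N2) :=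
      (Fintype.two_lt_card_iff).mpr ⟨x, z, 0, hxz, hx, hz⟩
    rw [← Nat.card_eq_fintype_card] at h3
    omega
  have hττx : ∀ x : K, τ (τ x) = x := fun x ↦ by
    change (τ * τ) x = x
    rw [hττ]
    rfl
  have hττm : ∀ Q : (W.baseChange K).toAffine.Point, τm (τm Q) = Q := fun Q ↦ by
    rcases Q with _ | ⟨x, y', h⟩
    · rfl
    · exact Affine.Point.some_eq_some_of_eq (hττx x) (hττx y')
  have hτN2 : ∀ Q : (W.baseChange K).toAffine.Point, τm Q - Q ∈ N2 := by
    intro Q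
    rw [← QuotientAddGroup.eq_iff_sub_mem]
    by_cases hQ : (QuotientAddGroup.mk Q : (W.baseChange K).toAffine.Point ⧸ N2) = 0
    · have hQmem : Q ∈ N2 := (QuotientAddGroup.eq_zero_iff Q).mp hQ
      obtain ⟨R, hR⟩ := (hmemN2 Q).mp hQmem
      have hτQ : τm Q ∈ N2 := (hmemN2 _).mpr ⟨τm R, by rw [← map_zsmul, hR]⟩
      rw [hQ, (QuotientAddGroup.eq_zero_iff _).mpr hτQ]
    · refine hV _ _ (fun hτQ ↦ hQ ?_) hQ
      obtain ⟨R, hR⟩ := (hmemN2 _).mp ((QuotientAddGroup.eq_zero_iff _).mp hτQ)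
      exact (QuotientAddGroup.eq_zero_iff Q).mpr ((hmemN2 Q).mpr ⟨τm R, by rw [← map_zsmul, hR, hττm]⟩)
  have hnp : ∀ Q : (W.baseChange K).toAffine.Point, τm Q - Q ≠ m • Q₀ := by
    intro Q hQ
    obtain ⟨R, hR⟩ := (hmemN2 _).mp (hQ ▸ hτN2 Q)
    obtain ⟨k, hk⟩ := hmodd
    refine hQ₀2 (R - (k : ℤ) • Q₀) ?_
    rw [smul_sub, hR, hk, smul_smul, ← natCast_zsmul Q₀ (2 * k + 1), ← sub_smul]
    push_cast
    rw [show (2 * (k : ℤ) + 1 - 2 * k) = 1 by ring, one_smul]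
  have hV2 : ∀ x z : (W.baseChange K).toAffine.Point, (¬ ∃ S : (W.baseChange K).toAffine.Point, (2 : ℤ) • S = x) →
      (¬ ∃ S : (W.baseChange K).toAffine.Point, (2 : ℤ) • S = z) → ∃ S : (W.baseChange K).toAffine.Point, (2 : ℤ) • S = x - z := by
    intro x z hx hz
    have hx' : (QuotientAddGroup.mk x : (W.baseChange K).toAffine.Point ⧸ N2) ≠ 0 := fun h ↦
      hx ((hmemN2 x).mp ((QuotientAddGroup.eq_zero_iff x).mp h))
    have hz' : (QuotientAddGroup.mk z : (W.baseChange K).toAffine.Point ⧸ N2) ≠ 0 := fun h ↦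
      hz ((hmemN2 z).mp ((QuotientAddGroup.eq_zero_iff z).mp h))
    exact (hmemN2 _).mp ((QuotientAddGroup.eq_iff_sub_mem).mp (hV _ _ hx' hz'))
  exact ⟨Q₀, m, hmodd, hQ₀2, h2tors, hPanti, fun Q ↦ (hmemN2 _).mp (hτN2 Q), hnp, hV2⟩

/-- **The Kramer class is non-zero, from the frame alone**: `ker(resBaseChange W K) ≠ 0`.  [cite: Kramer1981, proof of Thm. 2]
[cite: GrossLMS1991, §5 Prop. 5.3] -/
theorem exists_ne_zero_resBaseChange_eq_zero_of_frame (h2 : Module.finrank ℚ K = 2) {τ : K ≃ₐ[ℚ] K} (hτ : τ ≠ 1)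
    (h2tors : ∀ P : (W.baseChange K).toAffine.Point, (2 : ℤ) • P = 0 → P = 0)
    (hrk : (W.baseChange K).mordellWeilRank ≤ 1)
    (y : (W.baseChange K).toAffine.Point) (M : ℕ)
    (hndiv : ∀ Q : (W.baseChange K).toAffine.Point, ((2 ^ (M + 1) : ℕ) : ℤ) • Q ≠ y)
    (hanti : IsOfFinAddOrder (Affine.Point.map (W' := W) (τ : K →ₐ[ℚ] K) y + y)) :
    ∃ η : W.galH1, η ≠ 0 ∧ resBaseChange W K η = 0 := by
  obtain ⟨Q₀, m, -, -, -, hPanti, -, hnp, -⟩ := exists_framePackage_of_rank_le_one W K h2 hτ h2tors hrk y M hndiv hanti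
  exact exists_ne_zero_resBaseChange_eq_zero_of_point K W h2 hτ (m • Q₀) hPanti hnp

/-- **τ-fixed points of `E(K)` are halvable by τ-fixed points, from the frame alone**: if `τd = d` then `d = S + S` with `τS = S`.
[cite: GrossLMS1991, §5 Prop. 5.3] [cite: SerreGaloisCohomology1997, I §2.6 (b)] -/
theorem exists_fixed_half_of_frame (h2 : Module.finrank ℚ K = 2) {τ : K ≃ₐ[ℚ] K} (hτ : τ ≠ 1)
    (h2tors : ∀ P : (W.baseChange K).toAffine.Point, (2 : ℤ) • P = 0 → P = 0)
    (hrk : (W.baseChange K).mordellWeilRank ≤ 1)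
    (y : (W.baseChange K).toAffine.Point) (M : ℕ)
    (hndiv : ∀ Q : (W.baseChange K).toAffine.Point, ((2 ^ (M + 1) : ℕ) : ℤ) • Q ≠ y)
    (hanti : IsOfFinAddOrder (Affine.Point.map (W' := W) (τ : K →ₐ[ℚ] K) y + y))
    (d : (W.baseChange K).toAffine.Point) (hd : Affine.Point.map (W' := W) (τ : K →ₐ[ℚ] K) d = d) :
    ∃ S : (W.baseChange K).toAffine.Point, Affine.Point.map (W' := W) (τ : K →ₐ[ℚ] K) S = S ∧ d = S + S := by
  obtain ⟨Q₀, m, -, hQ₀2, h2tors', hPanti, -, hnp, hV2⟩ := exists_framePackage_of_rank_le_one W K h2 hτ h2tors hrk y M hndiv hanti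
  set τm := WeierstrassCurve.Affine.Point.map (W' := W) (τ : K →ₐ[ℚ] K) with hτm
  by_cases hdN : ∃ S : (W.baseChange K).toAffine.Point, (2 : ℤ) • S = d
  · obtain ⟨S, hS⟩ := hdN
    refine ⟨S, ?_, by rw [← two_zsmul, hS]⟩
    have h0 : (2 : ℤ) • (τm S - S) = 0 := by rw [smul_sub, ← map_zsmul, hS, hd, sub_self]
    exact sub_eq_zero.mp (h2tors' _ h0)
  · exfalso
    obtain ⟨S, hS⟩ := hV2 d Q₀ hdN (fun ⟨S, hS⟩ ↦ hQ₀2 S hS)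
    refine hnp (m • S) (sub_eq_zero.mp (h2tors' _ ?_))
    have hPanti' : m • τm Q₀ = -(m • Q₀) := by
      rw [← map_nsmul]
      exact eq_neg_of_add_eq_zero_left hPanti
    have h2S : (2 : ℤ) • τm S = d - τm Q₀ := by rw [← map_zsmul, hS, map_sub, hd]
    rw [smul_sub, smul_sub, map_nsmul, smul_comm (2 : ℤ) m (τm S), h2S, smul_comm (2 : ℤ) m S, hS, smul_sub, smul_sub,
      hPanti', two_zsmul]
    abel

/-- **τ-INVARIANT CLASSES OF `H¹(K, E_K)` ARE RESTRICTIONS, from the frame alone**: for the non-trivial `σ ∈ Aut(K/ℚ)` and its chosen lift,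
every `s ∈ H¹(K, E_K)` with `τ_* s = s` is `res b` for some `b ∈ H¹(ℚ, E)` (the LEAD's `exists_resBaseChange_eq_of_conjH1Points_eq_of_twoDivisible`
fed with `exists_fixed_half_of_frame`).  [cite: SerreGaloisCohomology1997, I §2.6 (b)] [cite: GrossLMS1991, §5 (5.1)–(5.3)] -/
theorem exists_resBaseChange_eq_of_conjH1Points_eq_of_frame (h2 : Module.finrank ℚ K = 2) {σ : K ≃ₐ[ℚ] K} (hσ1 : σ ≠ 1)
    (h2tors : ∀ P : (W.baseChange K).toAffine.Point, (2 : ℤ) • P = 0 → P = 0)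
    (hrk : (W.baseChange K).mordellWeilRank ≤ 1)
    (y : (W.baseChange K).toAffine.Point) (M : ℕ)
    (hndiv : ∀ Q : (W.baseChange K).toAffine.Point, ((2 ^ (M + 1) : ℕ) : ℤ) • Q ≠ y)
    (hanti : IsOfFinAddOrder (Affine.Point.map (W' := W) (σ : K →ₐ[ℚ] K) y + y))
    {s : (W.baseChange K).galH1} (hs : (isLiftOfAut_liftAut σ).conjH1Points W s = s) :
    ∃ b : W.galH1, resBaseChange W K b = s := by
  haveI : Algebra.IsQuadraticExtension ℚ K := ⟨h2⟩
  haveI : IsGalois ℚ K := inferInstance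
  haveI hNn : (galRange (K := ℚ) K).Normal := normal_galRange K h2 hσ1
  have hc := xor_galRange K h2 hσ1
  have hτ : IsLiftOfAut σ (liftAut σ) := isLiftOfAut_liftAut σ
  refine exists_resBaseChange_eq_of_conjH1Points_eq_of_twoDivisible K W h2 hσ1 (fun P hP ↦ ?_) hs
  have hfix : ∀ g : Field.absoluteGaloisGroup K,
      g • geomPointsEquivBaseChange K W P = geomPointsEquivBaseChange K W P := fun g ↦ by
    rw [← geomPointsEquivBaseChange_smul', Subgroup.smul_def, hP]
  obtain ⟨d, hd⟩ := exists_toGeomPoints_eq_of_forall_smul_eq (W.baseChange K) hfix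
  have hσd : Affine.Point.map (W' := W) (σ : K →ₐ[ℚ] K) d = d := by
    apply toGeomPoints_injective (W.baseChange K)
    rw [← hτ.pointsMap_toGeomPoints, hd, ← geomPointsEquivBaseChange_conj, hP]
  obtain ⟨S, hS, hdS⟩ := exists_fixed_half_of_frame W K h2 hσ1 h2tors hrk y M hndiv hanti d hσd
  refine ⟨(geomPointsEquivBaseChange K W).symm (toGeomPoints (W.baseChange K) S), fun g ↦ ?_, ?_⟩
  · have hN' : ∀ n : galRange (K := ℚ) K,
        (n : Field.absoluteGaloisGroup ℚ) • (geomPointsEquivBaseChange K W).symm (toGeomPoints (W.baseChange K) S) =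
          (geomPointsEquivBaseChange K W).symm (toGeomPoints (W.baseChange K) S) := fun n ↦ by
      rw [← Subgroup.smul_def, ← geomPointsEquivBaseChange_symm_smul, smul_toGeomPoints]
    have hc' : liftToAbsGal (K := ℚ) K σ • (geomPointsEquivBaseChange K W).symm (toGeomPoints (W.baseChange K) S) =
        (geomPointsEquivBaseChange K W).symm (toGeomPoints (W.baseChange K) S) := by
      apply (geomPointsEquivBaseChange K W).injective
      rw [geomPointsEquivBaseChange_conj, AddEquiv.apply_symm_apply, hτ.pointsMap_toGeomPoints, hS]
    rcases exists_eq_or_eq_mul hc g with ⟨n, rfl⟩ | ⟨n, rfl⟩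
    · exact hN' n
    · rw [mul_smul, hc', hN' n]
  · apply (geomPointsEquivBaseChange K W).injective
    rw [map_add, AddEquiv.apply_symm_apply, ← hd, hdS, map_add]

end Frame

/-! ## §2 The relaxed group `res⁻¹(Ш(E/K)[2^∞])` is finite and counted by the `ℚ`-side and the relaxed index -/

section Relaxed

variable (W : WeierstrassCurve ℚ) [W.IsElliptic] (K : Type) [Field K] [NumberField K]

omit [W.IsElliptic] in
/-- **`res⁻¹(Ш(E/K)[2^∞])` is finite with `#res⁻¹(Ш(E/K)[2^∞]) ≤ #Ш(E/ℚ)[2^∞] · [res⁻¹Ш(E_K) : Ш(E/ℚ) ∩ res⁻¹Ш(E_K)]`** whenever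
`Ш(E/ℚ)[2^∞]` is finite and the relaxed index is finite (`K` quadratic, `σ₀ ≠ 1`): an element `b` of the relaxed group with `b ∈ Ш(E/ℚ)` is
`2`-power torsion (`2^k · res b = 0 ⟹ 2^(k+1) · b = 0`, `cor ∘ res = 2`), so `Ш(E/ℚ) ∩ res⁻¹(X) ↪ Ш(E/ℚ)[2^∞]`, and
`[res⁻¹(X) : Ш(E/ℚ) ∩ res⁻¹(X)] ≤ [res⁻¹Ш(E_K) : Ш(E/ℚ) ∩ res⁻¹Ш(E_K)]`.  [cite: Kramer1981, §2 Prop. 3 and Thm. 1]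
[cite: SerreGaloisCohomology1997, I §2.4 Prop. 9] -/
theorem finite_and_natCard_comap_resBaseChange_shaPrimary_le_of_relIndex (h2 : Module.finrank ℚ K = 2) {σ₀ : K ≃ₐ[ℚ] K}
    (hσ₀ : σ₀ ≠ 1) [Finite (AddCommGroup.primaryComponent (↥W.sha) 2)]
    (hne : (W.sha).relIndex (((W.baseChange K).sha).comap (resBaseChange W K)) ≠ 0) :
    Finite (((AddCommGroup.primaryComponent (↥(W.baseChange K).sha) 2).map (W.baseChange K).sha.subtype).comap (resBaseChange W K)) ∧
      Nat.card (((AddCommGroup.primaryComponent (↥(W.baseChange K).sha) 2).map (W.baseChange K).sha.subtype).comap (resBaseChange W K)) ≤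
        Nat.card (AddCommGroup.primaryComponent (↥W.sha) 2) * (W.sha).relIndex (((W.baseChange K).sha).comap (resBaseChange W K)) := by
  set Y : AddSubgroup ↥W.sha := AddCommGroup.primaryComponent (↥W.sha) 2 with hY
  set R₂ := ((AddCommGroup.primaryComponent (↥(W.baseChange K).sha) 2).map (W.baseChange K).sha.subtype).comap (resBaseChange W K)
    with hR₂
  set R := ((W.baseChange K).sha).comap (resBaseChange W K) with hR
  have hle : R₂ ≤ R := by
    intro b hb
    rw [hR, AddSubgroup.mem_comap]
    exact ((mem_comap_resBaseChange_shaPrimary_iff W (K := K) b).mp hb).1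
  -- `Ш(E/ℚ) ∩ R₂ ↪ Y`
  have hmemY : ∀ b : (W.sha).addSubgroupOf R₂, (⟨((b : R₂) : W.galH1), AddSubgroup.mem_addSubgroupOf.mp b.2⟩ : ↥W.sha) ∈ Y := by
    intro b
    obtain ⟨-, k, hk⟩ := (mem_comap_resBaseChange_shaPrimary_iff W (K := K) ((b : R₂) : W.galH1)).mp (b : R₂).2
    apply (AddCommGroup.mem_primaryComponent).mpr
    refine ⟨k + 1, Subtype.ext ?_⟩
    have hv : (2 : ℕ) • ((2 ^ k : ℕ) • ((b : R₂) : W.galH1)) = 0 := by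
      apply two_nsmul_eq_zero_of_resBaseChange_eq_zero W h2 hσ₀
      rw [map_nsmul]
      exact hk
    rw [AddSubgroupClass.coe_nsmul, ZeroMemClass.coe_zero, pow_succ, mul_smul]
    first
      | exact hv
      | (rw [smul_comm]; exact hv)
  let ι : (W.sha).addSubgroupOf R₂ → Y := fun b ↦ ⟨_, hmemY b⟩
  have hι : Function.Injective ι := by
    intro a b hab
    have h := congrArg (fun z : Y ↦ ((z : ↥W.sha) : W.galH1)) hab
    exact Subtype.ext (Subtype.ext h)
  haveI hfinI : Finite ((W.sha).addSubgroupOf R₂) := Finite.of_injective ι hι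
  have hcardI : Nat.card ((W.sha).addSubgroupOf R₂) ≤ Nat.card Y := Nat.card_le_card_of_injective ι hι
  -- the relaxed index of `R₂` is at most that of `R`
  have hidx0 : (W.sha).relIndex R₂ ≠ 0 := fun h ↦ hne (AddSubgroup.relIndex_eq_zero_of_le_right hle h)
  have hidx : (W.sha).relIndex R₂ ≤ (W.sha).relIndex R := AddSubgroup.relIndex_le_of_le_right hle hne
  have hsplit : Nat.card ((W.sha).addSubgroupOf R₂) * (W.sha).relIndex R₂ = Nat.card R₂ := AddSubgroup.card_mul_index _
  have hfin : Finite R₂ := by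
    apply Nat.finite_of_card_ne_zero
    rw [← hsplit]
    exact mul_ne_zero (Nat.card_pos.ne') hidx0
  refine ⟨hfin, ?_⟩
  rw [← hsplit]
  exact Nat.mul_le_mul hcardI hidx

end Relaxed

end Summit.BirchSwinnertonDyer.BirchSwinnertonDyer.Theorems.GenusExact.PlusDescent

end
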